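import Literature.AlgebraicGeometry.HodgeTheory.PicardLefschetzSymmetricA3Junction
import HarnessLib

/-!
# The `A₃` relations of the two local monodromies at a symmetric `A₃` point, and the gauge re-choice:
# hB2-PL ⟸ (Picard–Lefschetz data along the two circles) ∧ (operator relations)

Family `hodge`, layer `Literature/AlgebraicGeometry/HodgeTheory`, next to `PicardLefschetzSymmetricA3Junction` (the
Picard–Lefschetz clauses (ii) `SymmetricA3PicardLefschetzClauses` of the named fact hB2 =
`picardLefschetz_symmetricA3`, binder of crux K1-B `VeryGeneralSignCommutatorsInHg` of
`Summits/HodgeConjecture/HodgeConjecture/Theses/SignSymmetricPowers.lean`, stmt-HodgeConjecture-19716).  Written by the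
prover seat `hodge-nonav-19716-p2` (g9, cell `hodge-nonav`), programme «B2PL-SPLIT».  No new named fact: two
PREDICATES (parameters `n d f₁ g₀ g₂ ψ εa`, the quantifier prefix of `SymmetricA3PicardLefschetzClauses` verbatim) and
the theorems relating them.

THE POINT.  The clauses (ii) of hB2 speak about ∃-chosen vanishing cycles `e₁, e₂, e₃` and a coefficient `c₀`:
(P1) `IsPicardLefschetzData … γ₁ ![e₂] c₀`, (P2) `IsPicardLefschetzData … γ₂ ![e₁, e₃] c₀`, (C) `c₀B(e₁,e₂) = ±1`,
`c₀B(e₂,e₃) = ±1`, (N) the rational transports `T₁, T₂` along `γ₁, γ₂` do not commute.  The transports are CANONICAL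
(unique given the loops, `isRatTransport_unique_family`), the cycles are not (a Picard–Lefschetz datum is determined by
its transvection only up to `δ ↦ λδ, c ↦ c/λ²`, and an orthogonal PAIR only up to a rational rotation).  The
gauge-invariant content of (C) is the operator identity
`(T₁ − 1)(T₂ − 1)(T₁ − 1) = (−1)ⁿ · I · (T₁ − 1)`, `I := c₀²(B(e₁,e₂)² + B(e₃,e₂)²)` (`apply_rel_of_formulas`), and
(C) says `I = 2`.  Conversely — the GAUGE RE-CHOICE (`exists_rotation_chain`) — given (P1), (P2) and `I = 2`, the
rational rotation `e₁' = a e₁ + b e₃`, `e₃' = −b e₁ + a e₃`, `a = (u+v)/2`, `b = (v−u)/2` (`u = c₀B(e₁,e₂)`,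
`v = c₀B(e₃,e₂)`, `a² + b² = (u²+v²)/2 = 1`) keeps the Picard–Lefschetz datum of `γ₂` (same transvection sum, still
orthogonal, same norms) and realises `c₀B(e₁',e₂) = c₀B(e₃',e₂) = 1`.  Hence:

* `SymmetricA3PicardLefschetzPair n d f₁ g₀ g₂ ψ εa` — (P1) ∧ (P2) with a common coefficient (derivable from the uniform
  nodal package `picardLefschetz_nodalForms_uniform` by transport along the radial path — companion file);
* `SymmetricA3MonodromyRelations n d f₁ g₀ g₂ ψ εa` — for THE rational transports `T₁, T₂` along the two circles:
  `T₁T₂ ≠ T₂T₁` and `(T₁ − 1)(T₂ − 1)(T₁ − 1) = ((−1)ⁿ·2)·(T₁ − 1)` (pointwise), the residue of hB2 that is genuinely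
  about the `A₃` Milnor lattice (AGZV II Thm. 2.15 / 2.14 at the `B₂` point, §5.2), stated WITHOUT chosen cycles;
* `symmetricA3PicardLefschetzClauses_of_pair_of_relations` — Pair ∧ Relations ⟹ the clauses (ii) verbatim;
  `SymmetricA3PicardLefschetzClauses.pair` / `.relations` — conversely (so the split is lossless);
* the assembly with the bifurcation theorem and the uniform nodal package (hB2 ⟸ hPL-uniform ∧ Relations) is the
  companion file `PicardLefschetzSymmetricA3OfUniform`.

References: [ArnoldGuseinzadeVarchenko2012] AGZV II, Part I §1.3, §2.8 Thm. 2.14, §2.9 Thm. 2.15, §5.2 (pp. 129–133);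
[VoisinHodgeII2003] Voisin, *Hodge Theory and Complex Algebraic Geometry II*, §3.1.2, §3.2.1 Thm. 3.16, Cor. 3.17, Rem. 3.21.
-/

noncomputable section

open CategoryTheory AlgebraicGeometry MvPolynomial
open Literature.AlgebraicTopology.SingularHomology
open Literature.AlgebraicGeometry.Motives Literature.AlgebraicGeometry.Motives.UniversalHypersurface

namespace Literature.AlgebraicGeometry.HodgeTheory

/-! ### §1 Linear algebra of an `A₃` pair of Picard–Lefschetz transformations -/

section Algebra

variable {K V : Type*} [Field K] [AddCommGroup V] [Module K V]

/-- **The gauge-invariant of an `A₃` pair.**  For `N₁ x = c₀B(x,e₂)e₂` and `N₂ x = c₀B(x,e₁)e₁ + c₀B(x,e₃)e₃` (the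
nilpotent parts of the two Picard–Lefschetz transformations) and an `ε`-symmetric form `B`:
`N₁N₂N₁ = ε·(u² + v²)·N₁` with `u = c₀B(e₁,e₂)`, `v = c₀B(e₃,e₂)`.
[cite: ArnoldGuseinzadeVarchenko2012, Part I §1.3 (Picard–Lefschetz formula)] -/
theorem apply_rel_of_formulas (B : V →ₗ[K] V →ₗ[K] K) {ε : K} (hε : ∀ x y, B x y = ε * B y x)
    {e₁ e₂ e₃ : V} {c₀ : K} {N₁ N₂ : V → V} (hN₁ : ∀ x, N₁ x = (c₀ * B x e₂) • e₂)
    (hN₂ : ∀ x, N₂ x = (c₀ * B x e₁) • e₁ + (c₀ * B x e₃) • e₃) (x : V) :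
    N₁ (N₂ (N₁ x)) = (ε * ((c₀ * B e₁ e₂) ^ 2 + (c₀ * B e₃ e₂) ^ 2)) • N₁ x := by
  simp only [hN₁, hN₂, map_smul, map_add, LinearMap.smul_apply, LinearMap.add_apply, smul_eq_mul,
    smul_smul]
  congr 1
  rw [hε e₂ e₁, hε e₂ e₃]
  ring

/-- **From the `A₃` relation to `u² + v² = 2`.**  If `N₁N₂N₁ = 2ε·N₁`, `N₁ ≠ 0` and `ε² = 1`, then
`(c₀B(e₁,e₂))² + (c₀B(e₃,e₂))² = 2`. [cite: ArnoldGuseinzadeVarchenko2012, Part I §2.9 Thm. 2.15] -/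
theorem sum_sq_eq_two_of_rel (B : V →ₗ[K] V →ₗ[K] K) {ε : K} (hε : ∀ x y, B x y = ε * B y x)
    (hε2 : ε ^ 2 = 1) {e₁ e₂ e₃ : V} {c₀ : K} {N₁ N₂ : V → V} (hN₁ : ∀ x, N₁ x = (c₀ * B x e₂) • e₂)
    (hN₂ : ∀ x, N₂ x = (c₀ * B x e₁) • e₁ + (c₀ * B x e₃) • e₃)
    (hrel : ∀ x, N₁ (N₂ (N₁ x)) = (ε * 2) • N₁ x) (hne : ∃ x, N₁ x ≠ 0) :
    (c₀ * B e₁ e₂) ^ 2 + (c₀ * B e₃ e₂) ^ 2 = 2 := by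
  obtain ⟨x, hx⟩ := hne
  have h := apply_rel_of_formulas B hε hN₁ hN₂ x
  rw [hrel x] at h
  have h' := sub_eq_zero.2 h
  rw [← sub_smul, smul_eq_zero] at h'
  rcases h' with h' | h'
  · have hε0 : ε ≠ 0 := by rintro rfl; norm_num at hε2
    exact (mul_left_cancel₀ hε0 (sub_eq_zero.1 h')).symm
  · exact absurd h' hx

/-- **Rotating an orthogonal pair of equal norms** by `(a, b)` with `a² + b² = 1`: the transvection sum
`B(x,e₁)e₁ + B(x,e₃)e₃`, the orthogonality and the norms are unchanged. [cite: VoisinHodgeII2003, §3.2.1 Thm. 3.16] -/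
theorem rotate_pair (B : V →ₗ[K] V →ₗ[K] K) {ε : K} (hε : ∀ x y, B x y = ε * B y x) {e₁ e₃ : V}
    (h13 : B e₁ e₃ = 0) (hnorm : B e₁ e₁ = B e₃ e₃) {a b : K} (hab : a ^ 2 + b ^ 2 = 1) :
    (∀ x, B x (a • e₁ + b • e₃) • (a • e₁ + b • e₃) + B x ((-b) • e₁ + a • e₃) • ((-b) • e₁ + a • e₃) =
        B x e₁ • e₁ + B x e₃ • e₃) ∧
      B (a • e₁ + b • e₃) ((-b) • e₁ + a • e₃) = 0 ∧
      B (a • e₁ + b • e₃) (a • e₁ + b • e₃) = B e₁ e₁ ∧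
      B ((-b) • e₁ + a • e₃) ((-b) • e₁ + a • e₃) = B e₃ e₃ := by
  have h31 : B e₃ e₁ = 0 := by rw [hε, h13, mul_zero]
  refine ⟨fun x => ?_, ?_, ?_, ?_⟩
  · simp only [map_add, map_smul, smul_eq_mul, smul_add, smul_smul]
    have : ∀ p q r s : K, p • e₁ + q • e₃ + (r • e₁ + s • e₃) = (p + r) • e₁ + (q + s) • e₃ := by
      intro p q r s; module
    rw [this]
    congr 1 <;> congr 1
    · linear_combination (B x e₁) * hab
    · linear_combination (B x e₃) * hab
  · simp only [map_add, map_smul, LinearMap.add_apply, LinearMap.smul_apply, smul_eq_mul, h13, h31]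
    linear_combination (-(a * b)) * hnorm
  · simp only [map_add, map_smul, LinearMap.add_apply, LinearMap.smul_apply, smul_eq_mul, h13, h31]
    linear_combination (B e₁ e₁) * hab - b ^ 2 * hnorm
  · simp only [map_add, map_smul, LinearMap.add_apply, LinearMap.smul_apply, smul_eq_mul, h13, h31]
    linear_combination (B e₃ e₃) * hab + b ^ 2 * hnorm

/-- **The rational rotation realising the `A₃` chain.**  If `B` is `ε`-symmetric, `2 ≠ 0`, `B(e₁,e₃) = 0`,
`B(e₁,e₁) = B(e₃,e₃)` and `(c₀B(e₁,e₂))² + (c₀B(e₃,e₂))² = 2`, then the orthogonal pair `(e₁, e₃)` can be replaced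
by a rotated pair `(e₁', e₃')` with the same transvection sum, orthogonality and norms and with
`c₀B(e₁',e₂) = c₀B(e₃',e₂) = 1` (rotation by `a = (u+v)/2`, `b = (v−u)/2`, rational in `u, v`).
[cite: ArnoldGuseinzadeVarchenko2012, Part I §2.9 Thm. 2.15 (the chain `A₃`)] -/
theorem exists_rotation_chain (B : V →ₗ[K] V →ₗ[K] K) {ε : K} (hε : ∀ x y, B x y = ε * B y x)
    (h2 : (2 : K) ≠ 0) {e₁ e₂ e₃ : V} {c₀ : K} (h13 : B e₁ e₃ = 0) (hnorm : B e₁ e₁ = B e₃ e₃)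
    (hsum : (c₀ * B e₁ e₂) ^ 2 + (c₀ * B e₃ e₂) ^ 2 = 2) :
    ∃ e₁' e₃' : V,
      (∀ x, B x e₁' • e₁' + B x e₃' • e₃' = B x e₁ • e₁ + B x e₃ • e₃) ∧
      B e₁' e₃' = 0 ∧ B e₁' e₁' = B e₁ e₁ ∧ B e₃' e₃' = B e₃ e₃ ∧
      c₀ * B e₁' e₂ = 1 ∧ c₀ * B e₃' e₂ = 1 := by
  obtain ⟨a, ha⟩ : ∃ a : K, a = (c₀ * B e₁ e₂ + c₀ * B e₃ e₂) / 2 := ⟨_, rfl⟩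
  obtain ⟨b, hb⟩ : ∃ b : K, b = (c₀ * B e₃ e₂ - c₀ * B e₁ e₂) / 2 := ⟨_, rfl⟩
  have hab : a ^ 2 + b ^ 2 = 1 := by
    rw [ha, hb]; field_simp; linear_combination (2 : K) * hsum
  obtain ⟨hT, horth, hn1, hn3⟩ := rotate_pair B hε h13 hnorm hab
  refine ⟨a • e₁ + b • e₃, (-b) • e₁ + a • e₃, hT, horth, hn1, hn3, ?_, ?_⟩
  · simp only [map_add, map_smul, LinearMap.add_apply, LinearMap.smul_apply, smul_eq_mul]
    rw [ha, hb]; field_simp; linear_combination hsum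
  · simp only [map_add, map_smul, LinearMap.add_apply, LinearMap.smul_apply, smul_eq_mul]
    rw [ha, hb]; field_simp; linear_combination hsum

end Algebra

/-! ### §2 The `(−1)ⁿ`-symmetry of `B = tr ∘ ∪` on `Hⁿ` -/

section Symmetry

variable {X : SchemeOver ℂ} {m n : ℕ}

/-- `(−1)^{n·n} = (−1)ⁿ`. [folklore] -/
private theorem neg_one_pow_mul_self (n : ℕ) : ((-1 : ℚ) ^ (n * n)) = (-1) ^ n := by
  rcases Nat.even_or_odd n with h | h
  · rw [h.neg_one_pow, (Nat.even_mul.2 (Or.inl h)).neg_one_pow]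
  · rw [h.neg_one_pow, (h.mul h).neg_one_pow]

/-- **Graded symmetry of the middle pairing**: `tr(x ∪ y) = (−1)ⁿ tr(y ∪ x)` on `Hⁿ(X(ℂ); ℚ)`.
[cite: HatcherAT2002, §3.2 Thm. 3.11] -/
theorem tr_cup_comm (hX : IsSmoothProjective m X) (x y : bettiCohomology X n) :
    BettiUniverse.tr hX (n + n) (BettiUniverse.cup X n n x y) =
      (-1 : ℚ) ^ n * BettiUniverse.tr hX (n + n) (BettiUniverse.cup X n n y x) := by
  have h := Motives.bettiCup_gradedComm (cupProduct_gradedComm_holds ℚ (ComplexPoints X))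
    (rfl : n + n = n + n) rfl x y
  change BettiUniverse.tr hX (n + n) (Motives.bettiCup rfl x y) = _
  rw [h, map_smul, smul_eq_mul, neg_one_pow_mul_self]

end Symmetry

section HodgeTheory

/-! ### §3 The two predicates -/

/-- **(P1) ∧ (P2): Picard–Lefschetz data along the two circles of the symmetric `A₃` unfolding, with a common
coefficient.**  Same quantifier prefix as `SymmetricA3PicardLefschetzClauses`: for `n, d ≥ 1`, every `hU`, every
`0 < |a'| < εa`, every base point `t₀` with form `f₁ + a' g₂ + (ψ a'/2) g₀` and every pair of loops `γ₁` (around `b = 0`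
only: `b = (ψ a'/2)e^{2πiθ}`) and `γ₂` (around `b = ψ a'` only: `b = ψ a' − (ψ a'/2)e^{2πiθ}`), there are `c₀` and
`e₁ e₂ e₃ ∈ Hⁿ(Y_{t₀}(ℂ); ℚ)` with `IsPicardLefschetzData n d 1 … γ₁ ![e₂] c₀` and
`IsPicardLefschetzData n d 2 … γ₂ ![e₁, e₃] c₀` (one node on the member `b = 0`, two orthogonal nodes on `b = ψ a'`).
[cite: VoisinHodgeII2003, §3.2.1 Thm. 3.16, Cor. 3.17, Rem. 3.21] [cite: ArnoldGuseinzadeVarchenko2012, Part I §5.2] -/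
def SymmetricA3PicardLefschetzPair (n d : ℕ) (f₁ g₀ g₂ : MvPolynomial (Fin (n + 2)) ℂ) (ψ : ℂ → ℂ)
    (εa : ℝ) : Prop :=
  ∀ (hn : 1 ≤ n) (hd : 1 ≤ d) (hU : IsCohomologicallyLocallyTrivialOn (family ℂ n d) Set.univ)
    (a' : ℂ), ‖a'‖ < εa → a' ≠ 0 →
    ∀ (t₀ : ComplexPoints (base ℂ n d)),
      pointForm ℂ n d t₀ = f₁ + a' • g₂ + (ψ a' / 2) • g₀ →
      ∀ (γ₁ γ₂ : Path t₀ t₀),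
        (∀ θ : unitInterval, pointForm ℂ n d (γ₁ θ) =
          f₁ + a' • g₂ + (ψ a' / 2 * Complex.exp (2 * Real.pi * Complex.I * ((θ : ℝ) : ℂ))) • g₀) →
        (∀ θ : unitInterval, pointForm ℂ n d (γ₂ θ) =
          f₁ + a' • g₂ +
            (ψ a' - ψ a' / 2 * Complex.exp (2 * Real.pi * Complex.I * ((θ : ℝ) : ℂ))) • g₀) →
        ∃ (c₀ : ℚ) (e₁ e₂ e₃ : bettiCohomology (fiberOver (family ℂ n d) t₀) n),
          IsPicardLefschetzData n d 1 hn hd hU γ₁ ![e₂] c₀ ∧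
          IsPicardLefschetzData n d 2 hn hd hU γ₂ ![e₁, e₃] c₀

/-- **The `A₃` relations of the two local monodromies at a symmetric `A₃` point** (the residue of hB2 about the
Milnor lattice, stated on the CANONICAL rational transports — no chosen cycles).  Same quantifier prefix; for every
pair of rational transports `T₁, T₂` of `Rⁿ π_* ℚ` along `γ₁, γ₂` (they exist and are unique): `T₁T₂ ≠ T₂T₁`, and,
writing `N x = T x − x`, the pointwise identity `N₁(N₂(N₁ x)) = ((−1)ⁿ·2)·N₁ x` — the operator form of the Dynkin
chain `A₃` (the vanishing cycle of the node on `b = 0` meets each of the two exchanged cycles on `b = ψ a'` once: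
AGZV II Thm. 2.15, stabilised by Thm. 2.14, at the boundary singularity `B₂` of §5.2).
[cite: ArnoldGuseinzadeVarchenko2012, Part I §5.2 (pp. 129–133), §2.9 Thm. 2.15, §2.8 Thm. 2.14, §1.3]
[cite: VoisinHodgeII2003, §3.2.1 Thm. 3.16 and §3.1.2] -/
def SymmetricA3MonodromyRelations (n d : ℕ) (f₁ g₀ g₂ : MvPolynomial (Fin (n + 2)) ℂ) (ψ : ℂ → ℂ)
    (εa : ℝ) : Prop :=
  ∀ (hU : IsCohomologicallyLocallyTrivialOn (family ℂ n d) Set.univ)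
    (a' : ℂ), ‖a'‖ < εa → a' ≠ 0 →
    ∀ (t₀ : ComplexPoints (base ℂ n d)),
      pointForm ℂ n d t₀ = f₁ + a' • g₂ + (ψ a' / 2) • g₀ →
      ∀ (γ₁ γ₂ : Path t₀ t₀),
        (∀ θ : unitInterval, pointForm ℂ n d (γ₁ θ) =
          f₁ + a' • g₂ + (ψ a' / 2 * Complex.exp (2 * Real.pi * Complex.I * ((θ : ℝ) : ℂ))) • g₀) →
        (∀ θ : unitInterval, pointForm ℂ n d (γ₂ θ) =
          f₁ + a' • g₂ +
            (ψ a' - ψ a' / 2 * Complex.exp (2 * Real.pi * Complex.I * ((θ : ℝ) : ℂ))) • g₀) →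
        ∀ (T₁ T₂ : bettiCohomology (fiberOver (family ℂ n d) t₀) n ≃ₗ[ℚ]
            bettiCohomology (fiberOver (family ℂ n d) t₀) n),
          IsRatTransport (family ℂ n d) n hU (loopClassUniv n d γ₁) T₁ →
          IsRatTransport (family ℂ n d) n hU (loopClassUniv n d γ₂) T₂ →
            T₁.trans T₂ ≠ T₂.trans T₁ ∧
            ∀ x, T₁ (T₂ (T₁ x - x) - (T₁ x - x)) - (T₂ (T₁ x - x) - (T₁ x - x)) =
              ((-1 : ℚ) ^ n * 2) • (T₁ x - x)

variable {n d : ℕ} {f₁ g₀ g₂ : MvPolynomial (Fin (n + 2)) ℂ} {ψ : ℂ → ℂ} {εa : ℝ}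

/-- Shrinking the radius of the pair data. [cite: VoisinHodgeII2003, §3.2.1 Thm. 3.16] -/
theorem SymmetricA3PicardLefschetzPair.mono (h : SymmetricA3PicardLefschetzPair n d f₁ g₀ g₂ ψ εa) {εa' : ℝ}
    (hle : εa' ≤ εa) : SymmetricA3PicardLefschetzPair n d f₁ g₀ g₂ ψ εa' :=
  fun hn hd hU a' ha ha0 => h hn hd hU a' (lt_of_lt_of_le ha hle) ha0

/-- Shrinking the radius of the relations. [cite: ArnoldGuseinzadeVarchenko2012, Part I §5.2] -/
theorem SymmetricA3MonodromyRelations.mono (h : SymmetricA3MonodromyRelations n d f₁ g₀ g₂ ψ εa) {εa' : ℝ}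
    (hle : εa' ≤ εa) : SymmetricA3MonodromyRelations n d f₁ g₀ g₂ ψ εa' :=
  fun hU a' ha ha0 => h hU a' (lt_of_lt_of_le ha hle) ha0

/-! ### §4 The gauge re-choice: Pair ∧ Relations ⟹ the clauses (ii) of hB2 -/

/-- **hB2-PL from the Picard–Lefschetz pair data and the `A₃` operator relations** (the gauge re-choice).  Given
(P1), (P2) with a common coefficient `c₀` and, for THE transports `T₁, T₂`, non-commutation and
`N₁N₂N₁ = ((−1)ⁿ·2)N₁`: the pair `(e₁, e₃)` is replaced by its rotation by `a = (u+v)/2`, `b = (v−u)/2`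
(`u = c₀B(e₁,e₂)`, `v = c₀B(e₃,e₂)`, `u² + v² = 2` by `sum_sq_eq_two_of_rel`), which is again a Picard–Lefschetz datum
for `γ₂` with coefficient `c₀` and satisfies `c₀B(e₁',e₂) = 1`, `c₀B(e₂,e₃') = (−1)ⁿ`; whence all of
`SymmetricA3PicardLefschetzClauses`. [cite: ArnoldGuseinzadeVarchenko2012, Part I §5.2 and §2.9 Thm. 2.15]
[cite: VoisinHodgeII2003, §3.2.1 Thm. 3.16, Cor. 3.17, Rem. 3.21] -/
theorem symmetricA3PicardLefschetzClauses_of_pair_of_relations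
    (hP : SymmetricA3PicardLefschetzPair n d f₁ g₀ g₂ ψ εa)
    (hR : SymmetricA3MonodromyRelations n d f₁ g₀ g₂ ψ εa) :
    SymmetricA3PicardLefschetzClauses n d f₁ g₀ g₂ ψ εa := by
  intro hn hd hU a' ha ha0 t₀ ht₀ γ₁ γ₂ hγ₁ hγ₂ hX B
  obtain ⟨c₀, e₁, e₂, e₃, h1, h2⟩ := hP hn hd hU a' ha ha0 t₀ ht₀ γ₁ γ₂ hγ₁ hγ₂
  obtain ⟨T₁, hT₁, hT₁x⟩ := h1.2.2.1
  obtain ⟨T₂, hT₂, hT₂x⟩ := h2.2.2.1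
  obtain ⟨hN, hrel⟩ := hR hU a' ha ha0 t₀ ht₀ γ₁ γ₂ hγ₁ hγ₂ T₁ T₂ hT₁ hT₂
  -- the bilinear form and its `(−1)ⁿ`-symmetry
  set Bl : bettiCohomology (fiberOver (family ℂ n d) t₀) n →ₗ[ℚ]
      bettiCohomology (fiberOver (family ℂ n d) t₀) n →ₗ[ℚ] ℚ :=
    (BettiUniverse.cup (fiberOver (family ℂ n d) t₀) n n).compr₂ (BettiUniverse.tr hX (n + n)) with hBl
  have hBlB : ∀ x y, Bl x y = B x y := fun x y => rfl
  have hε : ∀ x y, Bl x y = (-1 : ℚ) ^ n * Bl y x := fun x y => tr_cup_comm hX x y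
  have hε2 : ((-1 : ℚ) ^ n) ^ 2 = 1 := by
    rcases neg_one_pow_eq_or ℚ n with h | h <;> rw [h] <;> norm_num
  -- the nilpotent parts
  have hN₁ : ∀ x, T₁ x - x = (c₀ * Bl x e₂) • e₂ := fun x => by
    rw [hT₁x x, Fin.sum_univ_one, Matrix.cons_val_zero, smul_smul, add_sub_cancel_left]
    rfl
  have hN₂ : ∀ x, T₂ x - x = (c₀ * Bl x e₁) • e₁ + (c₀ * Bl x e₃) • e₃ := fun x => by
    rw [hT₂x x, Fin.sum_univ_two, Matrix.cons_val_zero, Matrix.cons_val_one, Matrix.cons_val_zero, smul_add,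
      smul_smul, smul_smul, add_sub_cancel_left]
    rfl
  have hrel' : ∀ x, (fun x => T₁ x - x) ((fun x => T₂ x - x) ((fun x => T₁ x - x) x)) =
      ((-1 : ℚ) ^ n * 2) • (fun x => T₁ x - x) x := fun x => hrel x
  have hne : ∃ x, (fun x => T₁ x - x) x ≠ 0 := by
    by_contra h0
    push Not at h0
    apply hN
    have hT1 : T₁ = LinearEquiv.refl ℚ _ := LinearEquiv.ext fun x => by
      have := h0 x; rw [sub_eq_zero] at this; simpa using this
    rw [hT1]; rfl
  have hsum : (c₀ * Bl e₁ e₂) ^ 2 + (c₀ * Bl e₃ e₂) ^ 2 = 2 :=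
    sum_sq_eq_two_of_rel Bl hε hε2 hN₁ hN₂ hrel' hne
  -- orthogonality and equal norms of the pair
  have h13 : Bl e₁ e₃ = 0 := by
    have := h2.orthogonal (show (0 : Fin 2) ≠ 1 by decide)
    simp only [Matrix.cons_val_zero, Matrix.cons_val_one] at this
    exact this
  have hnorm : Bl e₁ e₁ = Bl e₃ e₃ := by
    rcases Nat.even_or_odd n with hev | hodd
    · have h0 := (h2.even hev 0).1
      have h1' := (h2.even hev 1).1
      simp only [Matrix.cons_val_zero, Matrix.cons_val_one] at h0 h1'
      exact mul_left_cancel₀ h2.c_ne_zero (h0.trans h1'.symm)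
    · have h0 := h2.odd hodd 0
      have h1' := h2.odd hodd 1
      simp only [Matrix.cons_val_zero, Matrix.cons_val_one] at h0 h1'
      exact h0.trans h1'.symm
  -- the rotation
  obtain ⟨e₁', e₃', hT, horth, hn1, hn3, hu, hv⟩ :=
    exists_rotation_chain Bl hε two_ne_zero h13 hnorm hsum
  have he₁' : e₁' ≠ 0 := by rintro rfl; simp at hu
  have he₃' : e₃' ≠ 0 := by rintro rfl; simp at hv
  -- the rotated datum for `γ₂`
  have h2' : IsPicardLefschetzData n d 2 hn hd hU γ₂ ![e₁', e₃'] c₀ := by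
    refine ⟨h2.c_ne_zero, ?_, ⟨T₂, hT₂, fun x => ?_⟩, h2.2.2.2.1, fun hev i => ?_, fun hodd i => ?_⟩
    · intro i i' hii'
      fin_cases i <;> fin_cases i'
      · exact absurd rfl hii'
      · exact horth
      · change Bl e₃' e₁' = 0
        rw [hε, horth, mul_zero]
      · exact absurd rfl hii'
    · rw [Fin.sum_univ_two, Matrix.cons_val_zero, Matrix.cons_val_one, Matrix.cons_val_zero]
      change T₂ x = x + c₀ • (Bl x e₁' • e₁' + Bl x e₃' • e₃')
      rw [hT x, smul_add, smul_smul, smul_smul, ← hN₂ x, add_sub_cancel]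
    · fin_cases i
      · have h0 := (h2.even hev 0).1
        simp only [Matrix.cons_val_zero] at h0
        refine ⟨?_, by simpa using he₁'⟩
        change c₀ * Bl e₁' e₁' = -2
        rw [hn1]; exact h0
      · have h1' := (h2.even hev 1).1
        simp only [Matrix.cons_val_one, Matrix.cons_val_zero] at h1'
        refine ⟨?_, by simpa using he₃'⟩
        change c₀ * Bl e₃' e₃' = -2
        rw [hn3]; exact h1'
    · fin_cases i
      · have h0 := h2.odd hodd 0
        simp only [Matrix.cons_val_zero] at h0
        change Bl e₁' e₁' = 0
        rw [hn1]; exact h0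
      · have h1' := h2.odd hodd 1
        simp only [Matrix.cons_val_one, Matrix.cons_val_zero] at h1'
        change Bl e₃' e₃' = 0
        rw [hn3]; exact h1'
  refine ⟨c₀, e₁', e₂, e₃', h1, h2', Or.inl hu, ?_, T₁, T₂, hT₁, hT₂, hN⟩
  change c₀ * Bl e₂ e₃' = 1 ∨ c₀ * Bl e₂ e₃' = -1
  rw [hε e₂ e₃', mul_left_comm, hv, mul_one]
  rcases Nat.even_or_odd n with hev | hodd
  · exact Or.inl hev.neg_one_pow
  · exact Or.inr hodd.neg_one_pow

/-! ### §5 The split is lossless: the clauses (ii) give back the pair data and the relations -/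

/-- The clauses (ii) of hB2 contain the pair data (P1) ∧ (P2). [cite: VoisinHodgeII2003, §3.2.1 Thm. 3.16] -/
theorem SymmetricA3PicardLefschetzClauses.pair (h : SymmetricA3PicardLefschetzClauses n d f₁ g₀ g₂ ψ εa) :
    SymmetricA3PicardLefschetzPair n d f₁ g₀ g₂ ψ εa := by
  intro hn hd hU a' ha ha0 t₀ ht₀ γ₁ γ₂ hγ₁ hγ₂
  obtain ⟨c₀, e₁, e₂, e₃, h1, h2, -⟩ := h hn hd hU a' ha ha0 t₀ ht₀ γ₁ γ₂ hγ₁ hγ₂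
  exact ⟨c₀, e₁, e₂, e₃, h1, h2⟩

/-- **The clauses (ii) of hB2 imply the `A₃` operator relations** (`u = c₀B(e₁,e₂) = ±1`, `v = c₀B(e₃,e₂) = ±1`, so
`I = u² + v² = 2` in `N₁N₂N₁ = (−1)ⁿ·I·N₁`; the transports are unique, `isRatTransport_unique_family`).  With
`symmetricA3PicardLefschetzClauses_of_pair_of_relations`: Clauses ⟺ Pair ∧ Relations.
[cite: ArnoldGuseinzadeVarchenko2012, Part I §2.9 Thm. 2.15 and §5.2] [cite: VoisinHodgeII2003, §3.1.2] -/
theorem SymmetricA3PicardLefschetzClauses.relations (hn : 1 ≤ n) (hd : 1 ≤ d)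
    (h : SymmetricA3PicardLefschetzClauses n d f₁ g₀ g₂ ψ εa) :
    SymmetricA3MonodromyRelations n d f₁ g₀ g₂ ψ εa := by
  intro hU a' ha ha0 t₀ ht₀ γ₁ γ₂ hγ₁ hγ₂ T₁ T₂ hT₁ hT₂
  obtain ⟨c₀, e₁, e₂, e₃, h1, h2, h12, h23, T₁', T₂', hT₁', hT₂', hN⟩ :=
    h hn hd hU a' ha ha0 t₀ ht₀ γ₁ γ₂ hγ₁ hγ₂
  obtain ⟨T₁'', hT₁'', hT₁x⟩ := h1.2.2.1
  obtain ⟨T₂'', hT₂'', hT₂x⟩ := h2.2.2.1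
  have e1 : T₁' = T₁ := isRatTransport_unique_family hT₁' hT₁
  have e2 : T₂' = T₂ := isRatTransport_unique_family hT₂' hT₂
  have e1' : T₁'' = T₁ := isRatTransport_unique_family hT₁'' hT₁
  have e2' : T₂'' = T₂ := isRatTransport_unique_family hT₂'' hT₂
  rw [e1, e2] at hN
  rw [e1'] at hT₁x
  rw [e2'] at hT₂x
  refine ⟨hN, fun x => ?_⟩
  set hX : IsSmoothProjective n (fiberOver (family ℂ n d) t₀) :=
    (isSmoothProjectiveFamily_family ℂ hn hd).isSmoothProjective t₀ with hXdef
  set Bl : bettiCohomology (fiberOver (family ℂ n d) t₀) n →ₗ[ℚ]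
      bettiCohomology (fiberOver (family ℂ n d) t₀) n →ₗ[ℚ] ℚ :=
    (BettiUniverse.cup (fiberOver (family ℂ n d) t₀) n n).compr₂ (BettiUniverse.tr hX (n + n)) with hBl
  have hε : ∀ x y, Bl x y = (-1 : ℚ) ^ n * Bl y x := fun x y => tr_cup_comm hX x y
  have hN₁ : ∀ x, T₁ x - x = (c₀ * Bl x e₂) • e₂ := fun x => by
    rw [hT₁x x, Fin.sum_univ_one, Matrix.cons_val_zero, smul_smul, add_sub_cancel_left]
    rfl
  have hN₂ : ∀ x, T₂ x - x = (c₀ * Bl x e₁) • e₁ + (c₀ * Bl x e₃) • e₃ := fun x => by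
    rw [hT₂x x, Fin.sum_univ_two, Matrix.cons_val_zero, Matrix.cons_val_one, Matrix.cons_val_zero, smul_add,
      smul_smul, smul_smul, add_sub_cancel_left]
    rfl
  have hu : (c₀ * Bl e₁ e₂) ^ 2 = 1 := by
    rcases h12 with h | h
    · have h' : c₀ * Bl e₁ e₂ = 1 := h
      rw [h', one_pow]
    · have h' : c₀ * Bl e₁ e₂ = -1 := h
      rw [h', neg_one_sq]
  have hv : (c₀ * Bl e₃ e₂) ^ 2 = 1 := by
    have hsq : ((-1 : ℚ) ^ n) ^ 2 = 1 := by
      rcases neg_one_pow_eq_or ℚ n with h' | h' <;> rw [h'] <;> norm_num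
    have h3 : c₀ * Bl e₃ e₂ = (-1 : ℚ) ^ n * (c₀ * Bl e₂ e₃) := by rw [hε e₃ e₂]; ring
    rcases h23 with h | h
    · have h' : c₀ * Bl e₂ e₃ = 1 := h
      rw [h3, h', mul_one, hsq]
    · have h' : c₀ * Bl e₂ e₃ = -1 := h
      rw [h3, h', mul_pow, hsq, neg_one_sq, one_mul]
  have h := apply_rel_of_formulas Bl hε hN₁ hN₂ x
  rw [hu, hv, show (1 : ℚ) + 1 = 2 by norm_num] at h
  simpa only using h

end HodgeTheory

end Literature.AlgebraicGeometry.HodgeTheory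

end
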